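import Summits.AnomalousDissipation.AnomalousDissipation.Theorems.BaireTransferDenseLoudDesignerForcesErgodicLine
import Literature.Analysis.FluidPDE.StokesTorusSemigroup

/-!
# The Stokes semigroup frame on `H` (line `ergodic-budget-selection-closing`,
# crux `BaireTransfer.DenseLoudDesignerForces`, stmt-AnomalousDissipation-1143) — tools stub S1 of block N-R

Sorry-free file over the landed vocabulary `…ErgodicLine.lean` (`Hsp = Torus.energySpace (Fin 3)`) and the landed
Stokes semigroup frame on the torus energy space (`Literature/Analysis/FluidPDE/StokesTorusSemigroup.lean`:
`Torus.exists_stokesSemigroupFrame d`, whose abstract core is `Literature/Analysis/FluidPDE/StokesTorusSemigroupDiagonal.lean`: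
`exists_semigroupFrame_diagonalPMap`, the semigroup frame of ANY Hilbert basis `b` and non-negative divergent symbol `m`).
Block N-R of the line builds the smooth model of the Navier–Stokes semiflow from the MILD (Duhamel) formulation
`y(t) = T(νt) y₀ − ∫₀ᵗ K(ν(t − s)) N(y, y) ds + …` on `C([0, τ]; Hsp)`; this file supplies its operator frame:

* `stub_stokesSemigroupFrameTools` (the REGISTERED tools stub, proved) — a Stokes eigenbasis `b` of `Hsp` with eigenvalues
  `0 < m i → ∞` and `A = stokesOperatorH (Fin 3) = b.diagonalPMap m`, the diagonal operators `S = (1 + A)^{-1/2}`,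
  `R = (1 + A)⁻¹ = S ∘ S`, the Stokes semigroup `T t = e^{-tA}` and the smoothing family `K t = A^{3/4} e^{-tA}`
  (`S (b i) = (1 + m i)^{-1/2} b i`, `R (b i) = (1 + m i)⁻¹ b i`, `T t (b i) = e^{-t m i} b i` (`t ≥ 0`),
  `K t (b i) = m i^{3/4} e^{-t m i} b i` (`t > 0`)), with the N0g conjuncts for `S, R` (injective self-adjoint compact
  contraction, the two resolvent identities, the frame identity `‖z‖² = ‖S z‖² + ⟪A (S z), S z⟫`), the contraction-semigroup
  laws, strong continuity, self-adjointness, compactness (`t > 0`) and `S`-commutation of `T`, the smoothing bound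
  `‖K t‖ ≤ t^{-3/4}`, `K (s + t) = T s ∘ K t`, `S`-commutation and strong continuity on `(0, ∞)` of `K`
  (the case `d = Fin 3` of `Torus.exists_stokesSemigroupFrame`).

References: P. Constantin, C. Foias, *Navier–Stokes Equations* (Univ. Chicago Press 1988), Ch. 4, (4.4)–(4.7),
(4.11)–(4.13); D. Henry, *Geometric Theory of Semilinear Parabolic Equations* (1981), Thm. 1.3.4, Thm. 1.4.3
(`‖A^α e^{-tA}‖ ≤ C_α t^{-α}`); A. Pazy, *Semigroups of Linear Operators* (1983), Thm. 2.6.13.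
Nothing is asserted; no definition is added.
-/

-- `Summit.<Summit>.<Problem>` is the tree's mandated summit-side namespace (CONVENTIONS §2); for this
-- single-conjunct summit the two coincide, so the duplicate is deliberate.
set_option linter.dupNamespace false

noncomputable section

open Set Function MeasureTheory Filter
open scoped InnerProductSpace

namespace Summit.AnomalousDissipation.AnomalousDissipation.Theorems.DenseLoudDesignerForces.Ergodic

open Literature.Analysis.FunctionSpaces Literature.Analysis.FunctionSpaces.Torus
open Literature.Analysis.FluidPDE Literature.Analysis.FluidPDE.Torus

/-- **Tools stub S1 — the Stokes semigroup frame on `H`.**  With `A` the Stokes operator on the energy space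
(`Torus.stokesOperatorH (Fin 3)`: self-adjoint, positive, diagonal in a Hilbert basis `b` of Stokes modes with eigenvalues
`0 < m i = 4π²|k|² → ∞`, `exists_hilbertBasis_stokes_holds`) there are such `b`, `m` with `A = b.diagonalPMap m` and bounded
operators `S = (1 + A)^{-1/2}`, `R = (1 + A)⁻¹`, `T t = e^{-tA}` (`t ≥ 0`; junk `T t = 1` for `t < 0`), `K t = A^{3/4} e^{-tA}`
(`t > 0`; junk `0` otherwise), all diagonal in `b`, such that: `S ∘ S = R`; `S` is injective, `‖S‖ ≤ 1`, self-adjoint and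
compact; `R v ∈ D(A)` with `R v + A (R v) = v` (`v ∈ H`) and `R (v + A v) = v` (`v ∈ D(A)`); the frame identity
`‖z‖² = ‖S z‖² + ⟪A (S z), S z⟫` (`S z ∈ D(A)`); `‖T t‖ ≤ 1` (`t ≥ 0`), `T 0 = 1`, `T (s + t) = T s ∘ T t` (`s, t ≥ 0`),
`t ↦ T t y` continuous on `ℝ`, `T t ∘ S = S ∘ T t`, `T t` self-adjoint (`t ≥ 0`) and compact (`t > 0`); `‖K t‖ ≤ t^{-3/4}`
(`t > 0`), `K (s + t) = T s ∘ K t` (`s ≥ 0`, `t > 0`), `K t ∘ S = S ∘ K t`, `t ↦ K t y` continuous on `(0, ∞)`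
(Constantin–Foias 1988 Ch. 4, (4.4)–(4.7), (4.11)–(4.13): `A w_j = λ_j w_j`, `λ_j → ∞`, functions of `A` act diagonally;
Henry 1981 Thm. 1.3.4, 1.4.3: `e^{-tA}` is an analytic contraction semigroup with `‖A^α e^{-tA}‖ ≤ C_α t^{-α}`; the tree's
`Torus.exists_stokesSemigroupFrame` at `d = Fin 3`).
[cite: ConstantinFoiasNSE1988, Ch. 4 (4.4)–(4.7), (4.11)–(4.13)] -/
theorem stub_stokesSemigroupFrameTools :
    ∃ (ι : Type) (b : HilbertBasis ι ℝ Hsp) (m : ι → ℝ) (S R : Hsp →L[ℝ] Hsp) (T K : ℝ → Hsp →L[ℝ] Hsp),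
      (∀ i, 0 < m i) ∧ Tendsto m cofinite atTop ∧ stokesOperatorH (Fin 3) = b.diagonalPMap m ∧
      (∀ i, S (b i) = ((1 + m i) ^ (-(1 / 2 : ℝ))) • b i) ∧ (∀ i, R (b i) = (1 + m i)⁻¹ • b i) ∧
      (∀ t i, 0 ≤ t → T t (b i) = Real.exp (-(t * m i)) • b i) ∧
      (∀ t i, 0 < t → K t (b i) = ((m i) ^ (3 / 4 : ℝ) * Real.exp (-(t * m i))) • b i) ∧
      S.comp S = R ∧ Function.Injective S ∧ ‖S‖ ≤ 1 ∧ IsSelfAdjoint S ∧ IsCompactOperator S ∧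
      (∀ v : Hsp, ∃ hv : R v ∈ (stokesOperatorH (Fin 3)).domain, R v + stokesOperatorH (Fin 3) ⟨R v, hv⟩ = v) ∧
      (∀ (v : Hsp) (hv : v ∈ (stokesOperatorH (Fin 3)).domain), R (v + stokesOperatorH (Fin 3) ⟨v, hv⟩) = v) ∧
      (∀ (z : Hsp) (hz : S z ∈ (stokesOperatorH (Fin 3)).domain),
        ‖z‖ ^ 2 = ‖S z‖ ^ 2 + ⟪stokesOperatorH (Fin 3) ⟨S z, hz⟩, S z⟫_ℝ) ∧
      (∀ t, 0 ≤ t → ‖T t‖ ≤ 1) ∧ T 0 = 1 ∧ (∀ s t, 0 ≤ s → 0 ≤ t → T (s + t) = (T s).comp (T t)) ∧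
      (∀ y : Hsp, Continuous fun t : ℝ => T t y) ∧ (∀ t, (T t).comp S = S.comp (T t)) ∧ (∀ t, 0 ≤ t → IsSelfAdjoint (T t)) ∧
      (∀ t, 0 < t → IsCompactOperator (T t)) ∧
      (∀ t, 0 < t → ‖K t‖ ≤ t ^ (-(3 / 4 : ℝ))) ∧ (∀ s t, 0 ≤ s → 0 < t → K (s + t) = (T s).comp (K t)) ∧
      (∀ t, (K t).comp S = S.comp (K t)) ∧ (∀ y : Hsp, ContinuousOn (fun t : ℝ => K t y) (Ioi 0)) :=
  exists_stokesSemigroupFrame (Fin 3)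

end Summit.AnomalousDissipation.AnomalousDissipation.Theorems.DenseLoudDesignerForces.Ergodic
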